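import Literature.Probability.Percolation.QuadCrossingRotationCoupling
import Literature.Probability.Percolation.QuadCrossingContinuityOfLemma51
import HarnessLib

/-!
# DKKMO's per-quad Corollary 1.3 from the two named facts (Thm. 1.2 `d_SS` half + SS11 Lemma 5.1)

Topic `Probability/Percolation`; a short proofs file next to `QuadCrossingRotationCoupling.lean`
(the named fact `dkkmo_theorem_1_2_schrammSmirnov`, DKKMO arXiv:2012.11672 Thm. 1.2, `d_SS` part, at
`q = 1` in the plane) and `QuadCrossingContinuityOfLemma51.lean`
(`dkkmo_crossing_rotation_invariance_of_schrammSmirnov_of_lemma_5_1`: the per-quad Corollary 1.3,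
`dkkmo_crossing_rotation_invariance` of `QuadCrossingRotationInvariance.lean`, from that half of
Theorem 1.2 TAKEN AS A HYPOTHESIS `hSS` and Schramm–Smirnov's Lemma 5.1).  Now that the `d_SS` half
is a named fact, the reduction reads between named facts:

* `dkkmo_crossing_rotation_invariance_of_theorem_1_2_of_lemma_5_1` —
  `dkkmo_theorem_1_2_schrammSmirnov → SchrammSmirnov2011_lemma_5_1 →
  dkkmo_crossing_rotation_invariance` (the printed proof line, §7.1 p. 43: "follows directly from
  Theorem 1.2 and the measurability of `𝒞(Q)` in the Schramm–Smirnov topology", the continuity of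
  `𝒞(Q)` under the limits being SS11 Lemma 5.1).

So the per-quad fact `dkkmo_crossing_rotation_invariance` is discharged as soon as these two are.

## References

* [DKKMO2020Rotational] arXiv:2012.11672v1, Thm. 1.2, Cor. 1.3 (q = 1), §7.1 p. 43.
* [SchrammSmirnov2011] Ann. Probab. 39 (2011), Lemma 5.1.
-/

noncomputable section

namespace Literature.Probability.Percolation

open QuadCrossing

/-- **DKKMO Cor. 1.3 (`q = 1`, per quad) from the named facts Thm. 1.2 (`d_SS` half) and SS11
Lemma 5.1**: `dkkmo_crossing_rotation_invariance_of_schrammSmirnov_of_lemma_5_1` fed with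
`dkkmo_theorem_1_2_schrammSmirnov` (verbatim its hypothesis `hSS`).
[cite: DKKMO2020Rotational, Cor. 1.3 (q = 1), proof §7.1 p. 43] -/
theorem dkkmo_crossing_rotation_invariance_of_theorem_1_2_of_lemma_5_1
    (h12 : dkkmo_theorem_1_2_schrammSmirnov) (h51 : SchrammSmirnov2011_lemma_5_1) :
    dkkmo_crossing_rotation_invariance :=
  dkkmo_crossing_rotation_invariance_of_schrammSmirnov_of_lemma_5_1 h12 h51

end Literature.Probability.Percolation

end
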